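import Mathlib
import Summits.NavierStokesRegularity.NavierStokesRegularity.Theses.FrozenSignCascade
import Summits.NavierStokesRegularity.NavierStokesRegularity.Theorems.FrozenSignCascadeTightEnvelopeContinuationAPriori
import Literature.Analysis.FluidPDE.NSKatoToClayHolds
import HarnessLib

/-!
# Route FrozenSignCascade · item `TightEnvelopeContinuation` (stmt-NavierStokesRegularity-10580)

**Theorem (`tightEnvelopeContinuation_proof`).** The route decl
`Summit.NavierStokesRegularity.NavierStokesRegularity.Theses.FrozenSignCascade.TightEnvelopeContinuation`
holds: for `ν > 0` and a Clay datum `u₀` (smooth, divergence free, rapidly decaying), if at every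
horizon `T₀` and every level `ε > 0` there is a radius `R` beyond which the critical envelope
`‖ξ‖² ‖V(t, ξ)‖` of every Fourier-side mild solution `V` on `[0, T]`, `T ≤ T₀`, from the Fourier
datum `a₀ = 𝓕⁻¹u₀` stays below `ε` (a **tight** envelope), then `u₀` launches a global smooth
solution with bounded energy in the sense of the Clay matrix
(`IsSmoothOnHalfSpace u ∧ IsSmoothOnHalfSpace p ∧ IsNavierStokesSolution ν 0 u₀ u p ∧ HasBoundedEnergy u`).

**Proof.** Unconditional; every ingredient is a theorem of the tree.
1. (*a priori*) Along any state of the continuation argument — a Tao-class solution `(u, p)` on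
   `[0, F]` from `u₀` together with its Fourier side `V`, mild on `[0, F]`, `u t = synthVel (V t)`,
   `V 0 = a₀` — the energy of `V(r)` is at most `2E(u₀)` (Leray's energy inequality
   `IsTaoSolutionOn.lintegral_enorm_sq_le` and Plancherel `lintegral_enorm_sq_le_of_synthVel`), and
   the hypothesis at horizon `T` and level `ε₀ = c/(13824π·3|B₁| + 1)`, `c = 4π²ν`, gives a tight
   envelope of a radius `R` depending on `(ν, u₀, T)` only; hence the order-`4` Fourier weights of
   `V(t')` are bounded uniformly by `hasDecay_four_of_tight` (helper `…APriori`).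
2. (*restart*) Therefore Picard's time of the Fourier-side restart from `V(t')`
   (`exists_isTaoSolutionOn_fourierPiece`) is uniform, and the restart induction of
   `NSKatoToClayHolds` / `BourgainPavlovicContinuation` — glue physically by `IsTaoSolutionOn.glue`,
   on the Fourier side by `IsFourierMild.glue`, identify on the overlap by `eq_of_isTaoSolutionOn` —
   reaches every `T` (`exists_isTaoSolutionOn_of_weightBound`, stated once and for all for an
   arbitrary uniform weight functional).
3. (*patching*) Tao-class solutions on `[0, n+1]` for all `n` give the global Clay-class solution
   (`IsTaoSolutionOn.global_of_nat`, `isNavierStokesSolution_and_smooth_iff`).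

This is the mechanism announced on the item's card (Lemarié-Rieusset 2016, Thm. 8.21 and its
proof: the local existence time at the `PM²` level is controlled by the tail
`limsup_{A→∞} sup_{‖ξ‖>A} ‖ξ‖²|û|` and the low frequencies, which the energy bounds), realised on
the tree's `IsFourierMild` / `IsTaoSolutionOn` classes.
-/

noncomputable section

set_option linter.dupNamespace false -- nested layout Summit.<S>.<Sub>, Sub = S (D-0017)

open MeasureTheory Set Metric Real Filter
open scoped ENNReal ComplexConjugate
open Literature.Analysis.FluidPDE Literature.Analysis.FluidPDE.FourierNS

namespace Summit.NavierStokesRegularity.NavierStokesRegularity.Theorems.TightEnvelope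

/-! ### The restart induction under a uniform weight bound -/

/-- **Continuation under a uniform bound of the order-`4` Fourier weights.** Let `ν > 0`, let
`a₀ : ℝ³ → ℂ³` be a Fourier datum (continuous, every polynomial decay, divergence-free symbol,
conjugation symmetric) with `HasDecay 4 A a₀`, and let `T > 0`. Suppose that along every state of
the continuation argument on `[0, F]`, `F ≤ T` — a Tao-class solution `(u, p)` from `synthVel a₀`
with a Fourier side `V`, mild on `[0, F]`, `u t = synthVel (V t)` on `[0, F]`, `V 0 = a₀` — the
weights obey `HasDecay 4 A (V t')` for all `t' ∈ [0, F]`. Then there is a Tao-class solution from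
`synthVel a₀` on `[0, T]`. (The restart induction of `NSKatoToClayHolds` /
`BourgainPavlovicContinuation`: Picard's time `T_P(2A)` of the Fourier restart piece is uniform, the
restart `T_P/4` before the end gains `T_P/2` per step.) -/
theorem exists_isTaoSolutionOn_of_weightBound {ν : ℝ} (hν : 0 < ν)
    {a₀ : EuclideanSpace ℝ (Fin 3) → Fin 3 → ℂ} (hcont : Continuous a₀)
    (hdecAll : ∀ K : ℕ, ∃ B, HasDecay K B a₀)
    (hdiv : ∀ ξ, ∑ l, (ξ l : ℂ) * a₀ ξ l = 0) (hconj : ∀ ξ l, a₀ (-ξ) l = conj (a₀ ξ l))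
    {T A : ℝ} (hT : 0 < T) (hA : HasDecay 4 A a₀)
    (hbounds : ∀ (F : ℝ) (u : ℝ → EuclideanSpace ℝ (Fin 3) → EuclideanSpace ℝ (Fin 3))
      (p : ℝ → EuclideanSpace ℝ (Fin 3) → ℝ) (V : ℝ → EuclideanSpace ℝ (Fin 3) → Fin 3 → ℂ),
      0 < F → F ≤ T → IsTaoSolutionOn F ν (synthVel a₀) u p →
      IsFourierMild (4 * π ^ 2 * ν) 4 0 F V → (∀ t ∈ Icc 0 F, u t = synthVel (V t)) → V 0 = a₀ →
      ∀ t' ∈ Icc 0 F, HasDecay 4 A (V t')) :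
    ∃ (u : ℝ → EuclideanSpace ℝ (Fin 3) → EuclideanSpace ℝ (Fin 3))
      (p : ℝ → EuclideanSpace ℝ (Fin 3) → ℝ), IsTaoSolutionOn T ν (synthVel a₀) u p := by
  have e2 : Fintype.card (Fin 3) + 1 = 4 := by simp
  set cF : ℝ := 4 * π ^ 2 * ν with hcF
  have hcF0 : 0 < cF := by positivity
  have hA0 : 0 ≤ A := hA.nonneg
  set TP : ℝ := picardTime (Fin 3) cF 4 (2 * A) with hTP
  have hTPpos : 0 < TP := picardTime_pos hcF0 _ _ (by positivity)
  set u₀ : EuclideanSpace ℝ (Fin 3) → EuclideanSpace ℝ (Fin 3) := synthVel a₀ with hu₀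
  /- the state of the induction -/
  set State : ℝ → (ℝ → EuclideanSpace ℝ (Fin 3) → EuclideanSpace ℝ (Fin 3)) →
      (ℝ → EuclideanSpace ℝ (Fin 3) → ℝ) → (ℝ → EuclideanSpace ℝ (Fin 3) → Fin 3 → ℂ) → Prop :=
    fun F u p V => IsTaoSolutionOn F ν u₀ u p ∧ IsFourierMild cF 4 0 F V ∧
      (∀ t ∈ Icc 0 F, u t = synthVel (V t)) ∧ V 0 = a₀ with hState
  /- the restart step -/
  have hstep : ∀ ⦃F : ℝ⦄ ⦃u : ℝ → EuclideanSpace ℝ (Fin 3) → EuclideanSpace ℝ (Fin 3)⦄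
      ⦃p : ℝ → EuclideanSpace ℝ (Fin 3) → ℝ⦄ ⦃V : ℝ → EuclideanSpace ℝ (Fin 3) → Fin 3 → ℂ⦄,
      0 < F → F ≤ T → State F u p V →
      ∃ (F' : ℝ) (u' : ℝ → EuclideanSpace ℝ (Fin 3) → EuclideanSpace ℝ (Fin 3))
        (p' : ℝ → EuclideanSpace ℝ (Fin 3) → ℝ) (V' : ℝ → EuclideanSpace ℝ (Fin 3) → Fin 3 → ℂ),
        (T ≤ F' ∨ F + TP / 2 ≤ F') ∧ F' ≤ T ∧ 0 < F' ∧ State F' u' p' V' := by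
    intro F u p V hF hFT hSt
    obtain ⟨h, hV, hsyn, hV0⟩ := hSt
    have hdecay : ∀ t' ∈ Icc 0 F, HasDecay 4 A (V t') := hbounds F u p V hF hFT h hV hsyn hV0
    set t' : ℝ := max (F / 2) (F - TP / 4) with ht'
    have ht'0 : 0 ≤ t' := le_max_of_le_left (by linarith)
    have ht'F : t' < F := max_lt (by linarith) (by linarith)
    have hFt' : F ≤ t' + TP := by linarith [le_max_right (F / 2) (F - TP / 4)]
    have ht'I : t' ∈ Icc 0 F := ⟨ht'0, ht'F.le⟩
    -- the restart piece from the Fourier-side state `V t'`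
    have hdecAll' : ∀ K : ℕ, ∃ B, HasDecay K B (V t') := fun K => by
      obtain ⟨B, hB⟩ := hV.decay K
      exact ⟨B, hB t'⟩
    have hdec4 : HasDecay (Fintype.card (Fin 3) + 1) A (V t') := by rw [e2]; exact hdecay t' ht'I
    obtain ⟨v, q, Wf, hv, hWf, hvsyn, hWf0⟩ := exists_isTaoSolutionOn_fourierPiece hν
      (hV.continuous_slice t') hdecAll' hdec4 (hV.divFree t') (hV.conjSymm t')
    rw [e2, ← hcF, ← hTP] at hv hWf
    have hvt' : synthVel (V t') = u t' := (hsyn t' ht'I).symm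
    rw [hvt'] at hv
    -- the physical glue
    have hglue := h.glue hv hν hTPpos ht'0 ht'F hFt'
    -- the agreement on the overlap
    have hagree : ∀ s ∈ Ico 0 (min (F - t') TP), u (s + t') = v s :=
      (h.translate ht'0 ht'F).eq_of_isTaoSolutionOn hv hν (by linarith) hTPpos
    -- the Fourier glue
    have hWf' : IsFourierMild cF 4 t' (t' + TP) (fun t => Wf (t - t')) := by
      have := hWf.translate t'
      simpa only [zero_add, add_comm TP t'] using this
    have hVt' : IsFourierMild cF 4 0 t' V := hV.mono le_rfl ht'0 ht'F.le
    have hjunction : V t' = (fun t => Wf (t - t')) t' := by simp only [sub_self, hWf0]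
    have hGlueF := hVt'.glue hWf' hjunction
    set F' : ℝ := min (t' + TP) T with hF'
    have hF'pos : 0 < F' := lt_min (by linarith) hT
    have hF'le : F' ≤ t' + TP := min_le_left _ _
    refine ⟨F', (fun t => if t < F then u t else v (t - t')),
      (fun t => if t < F then p t else q (t - t')), (fun t => if t ≤ t' then V t else Wf (t - t')),
      ?_, min_le_right _ _, hF'pos, ?_, ?_, ?_, ?_⟩
    · by_cases hcase : t' + TP ≤ T
      · right; rw [hF', min_eq_left hcase]; linarith [le_max_right (F / 2) (F - TP / 4)]
      · left; rw [hF', min_eq_right (le_of_not_ge hcase)]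
    · exact hglue.mono hF'pos hF'le
    · exact hGlueF.mono le_rfl hF'pos.le hF'le
    · -- synthesis at every time of `[0, F']`
      intro t ht
      by_cases htt' : t ≤ t'
      · have htF : t < F := lt_of_le_of_lt htt' ht'F
        simp only [if_pos htF, if_pos htt']
        exact hsyn t ⟨ht.1, htF.le⟩
      · have hgt : t' < t := not_le.1 htt'
        simp only [if_neg htt']
        by_cases htF : t < F
        · simp only [if_pos htF]
          have hs : t - t' ∈ Ico 0 (min (F - t') TP) :=
            ⟨by linarith, lt_min (by linarith) (by linarith [ht.2])⟩
          have := hagree (t - t') hs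
          rw [sub_add_cancel] at this
          rw [this, hvsyn]
        · simp only [if_neg htF]
          exact hvsyn (t - t')
    · -- the initial Fourier datum is unchanged
      show (if (0 : ℝ) ≤ t' then V 0 else Wf (0 - t')) = a₀
      rw [if_pos ht'0, hV0]
  /- the first state -/
  have hbase : ∃ (F : ℝ) (u : ℝ → EuclideanSpace ℝ (Fin 3) → EuclideanSpace ℝ (Fin 3))
      (p : ℝ → EuclideanSpace ℝ (Fin 3) → ℝ) (V : ℝ → EuclideanSpace ℝ (Fin 3) → Fin 3 → ℂ),
      0 < F ∧ F ≤ T ∧ State F u p V := by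
    have hA' : HasDecay (Fintype.card (Fin 3) + 1) A a₀ := by rw [e2]; exact hA
    obtain ⟨u, p, V, hu, hV, hsyn, hV0⟩ := exists_isTaoSolutionOn_fourierPiece hν
      hcont hdecAll hA' hdiv hconj
    rw [e2, ← hcF] at hu hV
    set T₀ : ℝ := picardTime (Fin 3) cF 4 (2 * A) with hT₀
    have hT₀pos : 0 < T₀ := picardTime_pos hcF0 _ _ (by positivity)
    set F₀ : ℝ := min T₀ T with hF₀
    have hF₀pos : 0 < F₀ := lt_min hT₀pos hT
    refine ⟨F₀, u, p, V, hF₀pos, min_le_right _ _, ?_, ?_, ?_, hV0⟩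
    · exact hu.mono hF₀pos (min_le_left _ _)
    · exact hV.mono le_rfl hF₀pos.le (min_le_left _ _)
    · exact fun t _ => hsyn t
  /- the induction -/
  have hiter : ∀ k : ℕ, ∃ (F : ℝ) (u : ℝ → EuclideanSpace ℝ (Fin 3) → EuclideanSpace ℝ (Fin 3))
      (p : ℝ → EuclideanSpace ℝ (Fin 3) → ℝ) (V : ℝ → EuclideanSpace ℝ (Fin 3) → Fin 3 → ℂ),
      0 < F ∧ F ≤ T ∧ State F u p V ∧ (T ≤ F ∨ (k : ℝ) * (TP / 2) ≤ F) := by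
    intro k
    induction k with
    | zero =>
      obtain ⟨F, u, p, V, hF, hFw, hSt⟩ := hbase
      exact ⟨F, u, p, V, hF, hFw, hSt, Or.inr (by simpa using hF.le)⟩
    | succ k ih =>
      obtain ⟨F, u, p, V, hF, hFw, hSt, halt⟩ := ih
      rcases le_or_gt T F with hdone | hlt
      · exact ⟨F, u, p, V, hF, hFw, hSt, Or.inl hdone⟩
      · obtain ⟨F', u', p', V', hprog, hF'w, hF'pos, hSt'⟩ := hstep hF hlt.le hSt
        refine ⟨F', u', p', V', hF'pos, hF'w, hSt', ?_⟩
        rcases hprog with hT' | hadv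
        · exact Or.inl hT'
        · rcases halt with hd | hk
          · exact absurd hd (not_le.2 hlt)
          · right
            push_cast
            linarith
  obtain ⟨k, hk⟩ := exists_nat_gt (T / (TP / 2))
  obtain ⟨F, u, p, V, hF, hFT, hSt, halt⟩ := hiter k
  have hTF : T ≤ F := by
    rcases halt with hd | hk'
    · exact hd
    · exfalso
      have h2 : T < (k : ℝ) * (TP / 2) := by rwa [div_lt_iff₀ (by positivity)] at hk
      linarith
  exact ⟨u, p, hSt.1.mono hT hTF⟩

/-! ### The item -/

/-- **`TightEnvelopeContinuation` holds** (item stmt-NavierStokesRegularity-10580 of route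
`FrozenSignCascade`): a tight critical Fourier envelope at every horizon along all Fourier-side
mild solutions from `𝓕⁻¹u₀` implies that `u₀` launches a global smooth bounded-energy (Clay)
solution. Energy inequality + tightness ⇒ uniform order-`4` weights (`hasDecay_four_of_tight`) ⇒
uniform restart time (`exists_isTaoSolutionOn_of_weightBound`) ⇒ Tao-class solutions of every
length ⇒ Clay solution (`IsTaoSolutionOn.global_of_nat`, `isNavierStokesSolution_and_smooth_iff`). -/
theorem tightEnvelopeContinuation_proof :
    Summit.NavierStokesRegularity.NavierStokesRegularity.Theses.FrozenSignCascade.TightEnvelopeContinuation := by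
  intro ν hν u₀ hu hd hdiv htight
  -- Tao-class solutions of every length suffice
  suffices hex : ∀ Tt : ℝ, 0 < Tt → ∃ (u : ℝ → EuclideanSpace ℝ (Fin 3) → EuclideanSpace ℝ (Fin 3))
      (p : ℝ → EuclideanSpace ℝ (Fin 3) → ℝ), IsTaoSolutionOn Tt ν u₀ u p by
    have hex' : ∀ n : ℕ, ∃ (u : ℝ → EuclideanSpace ℝ (Fin 3) → EuclideanSpace ℝ (Fin 3))
        (p : ℝ → EuclideanSpace ℝ (Fin 3) → ℝ), IsTaoSolutionOn ((n : ℝ) + 1) ν u₀ u p := fun n =>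
      hex _ (by positivity)
    choose U P hUP using hex'
    obtain ⟨hcl, h0, hEn⟩ := IsTaoSolutionOn.global_of_nat hUP hν
    obtain ⟨hns, hsu, hsp⟩ := isNavierStokesSolution_and_smooth_iff.2 ⟨hcl, h0⟩
    exact ⟨_, _, hsu, hsp, hns, hEn⟩
  intro Tt hTt
  -- the heat rate and the smallness level
  set cF : ℝ := 4 * π ^ 2 * ν with hcF
  have hcF0 : 0 < cF := by positivity
  set CE : ℝ := 3 * (volume (ball (0 : EuclideanSpace ℝ (Fin 3)) 1)).toReal with hCE
  have hCE0 : 0 ≤ CE := by positivity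
  set ε₀ : ℝ := cF / (13824 * π * CE + 1) with hε₀
  have hden : 0 < 13824 * π * CE + 1 := by positivity
  have hε₀pos : 0 < ε₀ := div_pos hcF0 hden
  have hεc : 13824 * π * ε₀ * CE ≤ cF := by
    have e : ε₀ * (13824 * π * CE + 1) = cF := by rw [hε₀]; field_simp
    nlinarith [hε₀pos.le]
  -- the tightness radius at horizon `Tt` and level `ε₀`
  obtain ⟨R, hRt⟩ := htight Tt hTt ε₀ hε₀pos
  set R' : ℝ := max R 1 with hR'
  have hR'1 : 1 ≤ R' := le_max_right _ _
  -- the datum, its weight and the energy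
  set a₀ : EuclideanSpace ℝ (Fin 3) → Fin 3 → ℂ := fourierData hu hd with ha₀
  obtain ⟨A₀, hA₀⟩ := hasDecay_fourierData hu hd 4
  have hA₀0 : 0 ≤ A₀ := hA₀.nonneg
  have hsynth₀ : synthVel a₀ = u₀ := by
    funext x
    ext l
    rw [synthVel_apply, show (fun ξ => a₀ ξ l) = fun ξ => fourierData hu hd ξ l from rfl,
      fourier_fourierData hu hd l]
    simp
  set e₀ : ℝ := 2 * VectorCalculus.kineticEnergy u₀ with he₀
  have he₀0 : 0 ≤ e₀ := mul_nonneg zero_le_two (kineticEnergy_nonneg _)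
  -- the large radius and the uniform weight
  set M : ℝ := A₀ + 36 * π * R' * e₀ * Tt with hM
  have hM0 : 0 ≤ M := by positivity
  set vB : ℝ := (volume (ball (0 : EuclideanSpace ℝ (Fin 3)) R')).toReal with hvB
  have hvB0 : 0 ≤ vB := ENNReal.toReal_nonneg
  set R₁ : ℝ := max (2 * R') (4608 * π * M * vB / cF) with hR₁
  have hR₁2 : 2 * R' ≤ R₁ := le_max_left _ _
  have hR₁' : 4608 * π * M * vB ≤ cF * R₁ := by
    have := le_max_right (2 * R') (4608 * π * M * vB / cF)
    rw [← hR₁, div_le_iff₀ hcF0] at this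
    linarith
  have hR₁0 : 0 ≤ R₁ := by linarith
  set Abig : ℝ := 2 * (A₀ + (1 + R₁) ^ 4 * (A₀ + 36 * π * R₁ * e₀ * Tt)) with hAbig
  have hA₀big : A₀ ≤ Abig := by
    have : 0 ≤ (1 + R₁) ^ 4 * (A₀ + 36 * π * R₁ * e₀ * Tt) := by positivity
    rw [hAbig]; linarith
  have hAbigdec : HasDecay 4 Abig a₀ := hA₀.mono hA₀big
  -- the restart induction under the a-priori bound
  rw [← hsynth₀]
  refine exists_isTaoSolutionOn_of_weightBound hν (continuous_fourierData hu hd)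
    (hasDecay_fourierData hu hd) (sum_mul_fourierData hu hd hdiv) (fourierData_conj_symm hu hd)
    hTt hAbigdec ?_
  intro F u p V hF hFT hTao hV hsyn hV0 t' ht'
  rw [hsynth₀] at hTao
  -- energy of the Fourier side
  have hE : ∀ r ∈ Icc 0 F, ∫ η, ‖V r η‖ ^ 2 ≤ e₀ := by
    intro r hr
    have hdecr : ∀ K : ℕ, ∃ B, HasDecay K B (V r) := fun K => by
      obtain ⟨B, hB⟩ := hV.decay K
      exact ⟨B, hB r⟩
    have hlin : ∫⁻ η, ‖V r η‖ₑ ^ 2 ≤ ENNReal.ofReal e₀ :=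
      calc ∫⁻ η, ‖V r η‖ₑ ^ 2 ≤ ∫⁻ x, ‖synthVel (V r) x‖ₑ ^ 2 :=
            lintegral_enorm_sq_le_of_synthVel (V r) (hV.continuous_slice r) hdecr
              (fun ξ l => hV.conjSymm r ξ l)
        _ = ∫⁻ x, ‖u r x‖ₑ ^ 2 := by rw [hsyn r hr]
        _ ≤ ENNReal.ofReal e₀ := hTao.lintegral_enorm_sq_le hF hν.le hr
    exact integral_norm_sq_le_of_lintegral hV he₀0 hlin
  -- the tight envelope along `V`
  have htightV : ∀ r ∈ Icc 0 F, ∀ ζ : EuclideanSpace ℝ (Fin 3), R' ≤ ‖ζ‖ →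
      ‖ζ‖ ^ 2 * ‖V r ζ‖ ≤ ε₀ := fun r hr ζ hζ =>
    hRt F hFT V hV hV0 r hr ζ ((le_max_left R 1).trans hζ)
  have hVA₀ : HasDecay 4 A₀ (V 0) := by rw [hV0]; exact hA₀
  exact hasDecay_four_of_tight hV hFT he₀0 hE hR'1 hε₀pos.le hεc htightV hVA₀ hR₁2 hR₁' t' ht'

end Summit.NavierStokesRegularity.NavierStokesRegularity.Theorems.TightEnvelope

end
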